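import Summits.QuantumFields.YangMills.Theorems.LuscherReductionTwistedTraceScalingCombTransport
import HarnessLib

/-!
# COMB-GAUGE PROPAGATION, layer 2: in the comb gauge every NON-WRAP link of a small-action configuration is within `2(L−1)√(2S)` of `1`, and every wrap link is
# within `2(L−1)√(2S)` of the wrap link of its base line (lane A of S-BASE, crux `TwistedTraceScaling` stmt-QuantumFields-20203; toward `ValleyLinkProxAt`, design note
# `pub/ym-fleet/ym-luscher-20007-p1/COARSE-DESIGN.md` §16)

`V = treeFix U` has every tree link equal to `1` (`…TreeGauge`: direction `2` with `x₂ ≠ −1`; direction `1` with `x₂ = 0`, `x₁ ≠ −1`; direction `0` with `x₁ = x₂ = 0`,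
`x₀ ≠ −1`) and every plaquette within `ε₁ = √(2S(U))` of `1` (`frobNorm_hol_treeFix_sub_one_le`).  Transporting with `frobNorm_line_sub_le` (`…CombTransport`):
* `fd_dir1_base2_le` — `‖V(z,1) − V(base2 z, 1)‖ ≤ (z₂.val)·ε₁` (down the direction-`2` tree line to height `0`);
* `fd_dir0_base2_le`, `fd_dir0_base1_le` — the same for direction `0`, then along direction `1` inside the base plane;
* ★★ `fd_treeFix_one_le_of_nonwrap` — every link `(z, k)` with `z_k ≠ −1` ("non-wrap") has `‖V(z,k) − 1‖_F ≤ 2(L−1)·√(2S(U))`;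
* ★ `fd_treeFix_wrap1_le`, `fd_treeFix_wrap0_le` — wrap links of directions `1`, `0` are within `2(L−1)√(2S)` of the wrap link of their base line
  (`V(base2 z, 1)` resp. `V(base1 z, 0)`); direction-`2` wrap links ARE the top layer `z₂ = −1`.
Layer 3 (successor): constancy of the three wrap families across their transverse planes and their commutator defects (boundary plaquettes), then `…AlmostCommutingSU2`.
HONEST FRAMING: bookkeeping on the discrete torus for a stub lane of a child of the CONDITIONAL reduction route (femto rung R2b1); not a gap, not Clay.
-/

set_option autoImplicit false

noncomputable section

open Matrix Real
open scoped Matrix BigOperators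
open Literature.MathematicalPhysics.QuantumFieldTheory
open Literature.MathematicalPhysics.QuantumLattice

namespace Summit.QuantumFields.YangMills.Theorems.FemtoTransferGap.TwoLattice.Flat

open Summit.QuantumFields.YangMills.Theorems.FemtoTransferGap
open Summit.QuantumFields.YangMills.Theorems.FemtoTransferGap.TwoLattice

variable {L : ℕ} [NeZero L]

/-! ## §1 Coordinates along lines -/

omit [NeZero L] in
/-- The running coordinate of `lineSite y j m` is `y j + m`. [folklore] -/
theorem lineSite_apply_self (y : Site 3 L) (j : Fin 3) (m : ℕ) : lineSite y j m j = y j + ((m : ℕ) : ZMod L) := by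
  unfold lineSite; rw [Pi.add_apply, Pi.single_eq_same]

omit [NeZero L] in
/-- The other coordinates of `lineSite y j m` are those of `y`. [folklore] -/
theorem lineSite_apply_ne (y : Site 3 L) {j k : Fin 3} (hk : k ≠ j) (m : ℕ) : lineSite y j m k = y k := by
  unfold lineSite; rw [Pi.add_apply, Pi.single_apply, if_neg hk, add_zero]

omit [NeZero L] in
/-- Coordinates of a shifted site. [folklore] -/
theorem shift_apply_ne (x : Site 3 L) {i k : Fin 3} (hk : k ≠ i) : (x.shift i) k = x k := by
  rw [Site.shift, Pi.add_apply, Pi.single_apply, if_neg hk, add_zero]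

/-- `lineSite (base2 z) 2 (z₂.val) = z`. [folklore] -/
theorem lineSite_base2 (z : Site 3 L) : lineSite (base2 z) 2 (z 2).val = z := by
  unfold lineSite; rw [natCast_val_eq, base2_add_single]

/-- `lineSite (base1 z) 1 (z₁.val) = base2 z`. [folklore] -/
theorem lineSite_base1 (z : Site 3 L) : lineSite (base1 z) 1 (z 1).val = base2 z := by
  unfold lineSite; rw [natCast_val_eq, base1_add_single]

/-! ## §2 Transport down to the base -/

section Comb

variable (U : GaugeConfig 3 L SU2)

/-- The uniform plaquette bound of the comb gauge, `ε₁ = √(2S(U))`. [folklore] -/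
theorem hol_treeFix_le (x : Site 3 L) (i j : Fin 3) (hij : i < j) :
    frobNorm (((plaquetteHolonomy (treeFix U) x i j : SU2) : Matrix (Fin 2) (Fin 2) ℂ) - 1) ≤ Real.sqrt (2 * wilsonAction su2Rep U) :=
  frobNorm_hol_treeFix_sub_one_le U x ⟨(i, j), hij⟩

/-- Direction-`2` links off the top layer are `1` in the comb gauge. [cite: SeilerLNP1982, §2] -/
theorem treeFix_two_eq_one {y : Site 3 L} (hy : y 2 ≠ -1) : treeFix U (y, 2) = 1 :=
  treeFix_eq_one_of_treeEdge U ((treeEdge_iff _).mpr (Or.inl ⟨rfl, hy⟩))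

/-- Direction-`1` links of the base plane off the wrap column are `1`. [cite: SeilerLNP1982, §2] -/
theorem treeFix_one_eq_one {y : Site 3 L} (hy2 : y 2 = 0) (hy1 : y 1 ≠ -1) : treeFix U (y, 1) = 1 :=
  treeFix_eq_one_of_treeEdge U ((treeEdge_iff _).mpr (Or.inr (Or.inl ⟨rfl, hy2, hy1⟩)))

/-- Direction-`0` links of the base line off the wrap point are `1`. [cite: SeilerLNP1982, §2] -/
theorem treeFix_zero_eq_one {y : Site 3 L} (hy1 : y 1 = 0) (hy2 : y 2 = 0) (hy0 : y 0 ≠ -1) : treeFix U (y, 0) = 1 :=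
  treeFix_eq_one_of_treeEdge U ((treeEdge_iff _).mpr (Or.inr (Or.inr ⟨rfl, hy1, hy2, hy0⟩)))

omit [NeZero L] in
/-- `fd X X = 0`, packaged for links equal to `1`. [folklore] -/
theorem fd_self (X : SU2) : fd X X = 0 := by unfold fd; rw [sub_self, frobNorm_zero]

/-- ★ **Down the direction-`2` line**: `‖V(z, i) − V(base2 z, i)‖ ≤ z₂.val·√(2S)` for `i ∈ {0, 1}` (`V = treeFix U`). [cite: Luscher1983, §2] -/
theorem fd_base2_le (z : Site 3 L) (i : Fin 3) (hi : i < 2) :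
    fd (treeFix U (z, i)) (treeFix U (base2 z, i)) ≤ (z 2).val * Real.sqrt (2 * wilsonAction su2Rep U) := by
  have h := frobNorm_line_sub_le (treeFix U) (base2 z) i 2 (ε := Real.sqrt (2 * wilsonAction su2Rep U)) (a := 0) (z 2).val
    (fun m _ => hol_treeFix_le U _ i 2 hi) (fun m hm => ?_)
  · rw [lineSite_base2] at h; simpa using h
  · have hne : lineSite (base2 z) 2 m 2 ≠ -1 := by
      rw [lineSite_apply_self, base2_apply, if_pos rfl, zero_add]; exact natCast_ne_neg_one_of_lt_val hm
    have hne' : (lineSite (base2 z) 2 m).shift i 2 ≠ -1 := by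
      rw [shift_apply_ne _ (by intro h; rw [h] at hi; exact lt_irrefl _ hi)]; exact hne
    constructor
    · rw [treeFix_two_eq_one U hne, fd_self]
    · rw [treeFix_two_eq_one U hne', fd_self]

/-- ★ **Along the base plane**: for `z` with `z₂ = 0`, `‖V(z, 0) − V(base1 z, 0)‖ ≤ z₁.val·√(2S)`. [cite: Luscher1983, §2] -/
theorem fd_base1_le (z : Site 3 L) (hz : z 2 = 0) :
    fd (treeFix U (z, 0)) (treeFix U (base1 z, 0)) ≤ (z 1).val * Real.sqrt (2 * wilsonAction su2Rep U) := by
  have hb : base2 z = z := by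
    funext j; rw [base2_apply]; by_cases hj : j = 2
    · rw [if_pos hj, hj, hz]
    · rw [if_neg hj]
  have h := frobNorm_line_sub_le (treeFix U) (base1 z) 0 1 (ε := Real.sqrt (2 * wilsonAction su2Rep U)) (a := 0) (z 1).val
    (fun m _ => hol_treeFix_le U _ 0 1 (by decide)) (fun m hm => ?_)
  · rw [lineSite_base1, hb] at h; simpa using h
  · have h1 : lineSite (base1 z) 1 m 1 ≠ -1 := by
      rw [lineSite_apply_self, base1_apply, if_neg (by decide), zero_add]; exact natCast_ne_neg_one_of_lt_val hm
    have h2 : lineSite (base1 z) 1 m 2 = 0 := by rw [lineSite_apply_ne _ (by decide), base1_apply, if_neg (by decide)]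
    have h1' : (lineSite (base1 z) 1 m).shift 0 1 ≠ -1 := by rw [shift_apply_ne _ (by decide)]; exact h1
    have h2' : (lineSite (base1 z) 1 m).shift 0 2 = 0 := by rw [shift_apply_ne _ (by decide)]; exact h2
    constructor
    · rw [treeFix_one_eq_one U h2 h1, fd_self]
    · rw [treeFix_one_eq_one U h2' h1', fd_self]

/-! ## §3 Non-wrap links are near `1`; wrap links are near their base representatives -/

/-- `z₂.val ≤ L − 1` as a real number. [folklore] -/
theorem val_le_pred (a : ZMod L) : ((a.val : ℕ) : ℝ) ≤ (L : ℝ) - 1 := by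
  have h := ZMod.val_lt a
  have hL : 1 ≤ L := NeZero.one_le
  have : (a.val : ℝ) ≤ ((L - 1 : ℕ) : ℝ) := by exact_mod_cast (by omega : a.val ≤ L - 1)
  rwa [Nat.cast_sub hL, Nat.cast_one] at this

/-- ★★ **Direction `2`, non-wrap**: `V(z,2) = 1` exactly (`z₂ ≠ −1`). [cite: SeilerLNP1982, §2] -/
theorem fd_treeFix_two_le {z : Site 3 L} (hz : z 2 ≠ -1) : fd (treeFix U (z, 2)) 1 = 0 := by rw [treeFix_two_eq_one U hz, fd_self]

/-- ★★ **Direction `1`, non-wrap** (`z₁ ≠ −1`): `‖V(z,1) − 1‖_F ≤ (L−1)·√(2S(U))`. [cite: Luscher1983, §2] -/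
theorem fd_treeFix_one_le {z : Site 3 L} (hz : z 1 ≠ -1) :
    fd (treeFix U (z, 1)) 1 ≤ ((L : ℝ) - 1) * Real.sqrt (2 * wilsonAction su2Rep U) := by
  have h := fd_base2_le U z 1 (by decide)
  have hb1 : base2 z 1 ≠ -1 := by rw [base2_apply, if_neg (by decide)]; exact hz
  have hb2 : base2 z 2 = 0 := by rw [base2_apply, if_pos rfl]
  rw [treeFix_one_eq_one U hb2 hb1] at h
  exact h.trans (mul_le_mul_of_nonneg_right (val_le_pred (z 2)) (Real.sqrt_nonneg _))

/-- ★★ **Direction `0`, non-wrap** (`z₀ ≠ −1`): `‖V(z,0) − 1‖_F ≤ 2(L−1)·√(2S(U))`. [cite: Luscher1983, §2] -/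
theorem fd_treeFix_zero_le {z : Site 3 L} (hz : z 0 ≠ -1) :
    fd (treeFix U (z, 0)) 1 ≤ 2 * ((L : ℝ) - 1) * Real.sqrt (2 * wilsonAction su2Rep U) := by
  have h1 := fd_base2_le U z 0 (by decide)
  have hb2 : base2 z 2 = 0 := by rw [base2_apply, if_pos rfl]
  have h2 := fd_base1_le U (base2 z) hb2
  have hb10 : base1 (base2 z) 0 ≠ -1 := by rw [base1_apply, if_pos rfl, base2_apply, if_neg (by decide)]; exact hz
  have hb11 : base1 (base2 z) 1 = 0 := by rw [base1_apply, if_neg (by decide)]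
  have hb12 : base1 (base2 z) 2 = 0 := by rw [base1_apply, if_neg (by decide)]
  rw [treeFix_zero_eq_one U hb11 hb12 hb10] at h2
  have hv1 := val_le_pred (z 2)
  have hv2 : (((base2 z 1).val : ℕ) : ℝ) ≤ (L : ℝ) - 1 := val_le_pred _
  have hs := Real.sqrt_nonneg (2 * wilsonAction su2Rep U)
  calc fd (treeFix U (z, 0)) 1 ≤ fd (treeFix U (z, 0)) (treeFix U (base2 z, 0)) + fd (treeFix U (base2 z, 0)) 1 := fd_triangle _ (treeFix U (base2 z, 0)) _
    _ ≤ (z 2).val * Real.sqrt (2 * wilsonAction su2Rep U) + (base2 z 1).val * Real.sqrt (2 * wilsonAction su2Rep U) := add_le_add h1 h2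
    _ ≤ ((L : ℝ) - 1) * Real.sqrt (2 * wilsonAction su2Rep U) + ((L : ℝ) - 1) * Real.sqrt (2 * wilsonAction su2Rep U) :=
        add_le_add (mul_le_mul_of_nonneg_right hv1 hs) (mul_le_mul_of_nonneg_right hv2 hs)
    _ = 2 * ((L : ℝ) - 1) * Real.sqrt (2 * wilsonAction su2Rep U) := by ring

/-- ★ **Direction-`1` wrap links** (`z₁ = −1`) are within `(L−1)√(2S)` of the wrap link of their base line `V(base2 z, 1)`. [cite: Luscher1983, §2] -/
theorem fd_treeFix_wrap1_le (z : Site 3 L) :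
    fd (treeFix U (z, 1)) (treeFix U (base2 z, 1)) ≤ ((L : ℝ) - 1) * Real.sqrt (2 * wilsonAction su2Rep U) :=
  (fd_base2_le U z 1 (by decide)).trans (mul_le_mul_of_nonneg_right (val_le_pred (z 2)) (Real.sqrt_nonneg _))

/-- ★ **Direction-`0` wrap links** (`z₀ = −1`) are within `2(L−1)√(2S)` of the wrap link of the base line `V(base1 (base2 z), 0) = V((−1,0,0), 0)`. [cite: Luscher1983, §2] -/
theorem fd_treeFix_wrap0_le (z : Site 3 L) :
    fd (treeFix U (z, 0)) (treeFix U (base1 (base2 z), 0)) ≤ 2 * ((L : ℝ) - 1) * Real.sqrt (2 * wilsonAction su2Rep U) := by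
  have h1 := fd_base2_le U z 0 (by decide)
  have hb2 : base2 z 2 = 0 := by rw [base2_apply, if_pos rfl]
  have h2 := fd_base1_le U (base2 z) hb2
  have hv1 := val_le_pred (z 2)
  have hv2 : (((base2 z 1).val : ℕ) : ℝ) ≤ (L : ℝ) - 1 := val_le_pred _
  have hs := Real.sqrt_nonneg (2 * wilsonAction su2Rep U)
  calc fd (treeFix U (z, 0)) (treeFix U (base1 (base2 z), 0))
      ≤ fd (treeFix U (z, 0)) (treeFix U (base2 z, 0)) + fd (treeFix U (base2 z, 0)) (treeFix U (base1 (base2 z), 0)) := fd_triangle _ (treeFix U (base2 z, 0)) _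
    _ ≤ (z 2).val * Real.sqrt (2 * wilsonAction su2Rep U) + (base2 z 1).val * Real.sqrt (2 * wilsonAction su2Rep U) := add_le_add h1 h2
    _ ≤ ((L : ℝ) - 1) * Real.sqrt (2 * wilsonAction su2Rep U) + ((L : ℝ) - 1) * Real.sqrt (2 * wilsonAction su2Rep U) :=
        add_le_add (mul_le_mul_of_nonneg_right hv1 hs) (mul_le_mul_of_nonneg_right hv2 hs)
    _ = 2 * ((L : ℝ) - 1) * Real.sqrt (2 * wilsonAction su2Rep U) := by ring

end Comb

end Summit.QuantumFields.YangMills.Theorems.FemtoTransferGap.TwoLattice.Flat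

end
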